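/-
HONEST FRAMING: certified error envelopes and provably optimal rounding/accumulation schemes for
low-precision formats under stated cost models; every table by two implementations; no hardware
or vendor claims.
-/
import Summits.Ventures.CertifiedArithmetic.LowPrec.OptDemotionLines
import Summits.Ventures.CertifiedArithmetic.LowPrec.OptDemotionRoutingTwoFam

/-!
# The demotion law (Theorem T8), part 10f: opt's TWO-FAMILY EFFICIENCY BOUNDS R21g (all trees, every `q`)

opt gen 14 (gen14/README §3, §3b; OPTIMA.md T8 (R21), (R21g)).  In the two-family coordinates of
part 10c (`u · BR_t{0,-i} = E_t(2^-i)`, `u · BR_t{0} = μ_t`, `E_t(ρ) = treeQf u t ρ - 1 - ρ`,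
`μ_t = treeM u t - 1`):

**R21g (THEOREM, every tree).**  `E_t(x) ≤ p(x) · μ_t` with `p(x) = (1 + u + x)/(1 + u + u²)`,
for every `u > 0` and every `x` with `u² ≤ x`, `u x ≤ 1` (`excess_le_ratio`; the pair
`{x, u/x}` is closed under the node recursion `treeQf_excess_node`, and the KEY IDENTITY
`x · p(u/x) = (1 + u) p(x) - 1` runs the induction — `twoFamRatio_node_half`, pure arithmetic).
In routing values: `BR_t{0, -i} ≤ p_i · BR_t{0}`, `p_i = (1 + u + 2^-i)/(1 + u + u²)`,
`1 ≤ i ≤ q - 1` (`treeBR_twoFam_ratio`); `i = q - 1` is R21's `p = (1+3u)/(1+u+u²)` (the exact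
all-tree supremum of `BR_t(1+2u)/BR_t(1)`, attained in the limit by doubling trees, opt R25) and
`i = 1` is R21's `r = (3+2u)/(2(1+u+u²))`.

**COROLLARY (the first o-side row for every `q`).**  At the top level `β = 2^(q-2)` and `A = 0`
the `O`-row of opt's split, `2 BR_t(β + ½) ≤ (1+ρ) BR_t(2β) + (1-ρ) BR_t(½)`, i.e.
`x_{q-1} ≤ (1 + ρ + (1-ρ) u) x_0`, holds for every tree as soon as
`u (1 - 2u - u²) ≤ ρ (1 - u³)` (opt's exact constant `ρ_o = u(1-2u-u²)/(1-u³) < u`), in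
particular at `ρ = u` (`treeBRv_oRow_top_zero`).  Part 10e packages it as `ORow q t ρ (q-2) 0`.
-/

namespace Summit.Ventures.CertifiedArithmetic.LowPrec.Opt

open Literature.ComputerArithmetic.JeannerodRump2018
open Literature.ComputerArithmetic.JeannerodRump2018.SumTree

/-! ## The node step (pure arithmetic) -/

/-- THE NODE STEP OF R21g for one argument `x` with partner `y = u/x`: children bounds
`X ≤ p m`, `Y ≤ p' m` (`m = μ ≥ 0`), `p ≥ 1`, `p u ≤ 1`, the key identity `x p' = p (1+u) - 1`,
and the two lower bounds `u + m_a + u m_b, u + m_b + u m_a ≤ μ_node` give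
`u + max (X_a + u m_b, X_b + u m_a, m_a + x Y_b, m_b + x Y_a) ≤ p μ_node`. -/
theorem twoFamRatio_node_half {u x p p' ma mb Xa Xb Ya Yb Mn : ℚ} (hu : 0 ≤ u) (hx : 0 ≤ x)
    (hp : 1 ≤ p) (hpu : p * u ≤ 1) (hid : x * p' = p * (1 + u) - 1)
    (hma : 0 ≤ ma) (hmb : 0 ≤ mb) (iXa : Xa ≤ p * ma) (iXb : Xb ≤ p * mb)
    (iYa : Ya ≤ p' * ma) (iYb : Yb ≤ p' * mb) (hM1 : u + (ma + u * mb) ≤ Mn)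
    (hM2 : u + (mb + u * ma) ≤ Mn) :
    u + max (max (Xa + u * mb) (Xb + u * ma)) (max (ma + x * Yb) (mb + x * Ya)) ≤ p * Mn := by
  have hp0 : 0 ≤ p := by linarith
  have k1 : p * (u + (ma + u * mb)) ≤ p * Mn := mul_le_mul_of_nonneg_left hM1 hp0
  have k2 : p * (u + (mb + u * ma)) ≤ p * Mn := mul_le_mul_of_nonneg_left hM2 hp0
  -- branch X_a + u m_b
  have b1 : u + (Xa + u * mb) ≤ p * Mn := by
    have : 0 ≤ (p - 1) * (u + u * mb) := mul_nonneg (by linarith) (by positivity)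
    nlinarith [iXa, k1]
  have b2 : u + (Xb + u * ma) ≤ p * Mn := by
    have : 0 ≤ (p - 1) * (u + u * ma) := mul_nonneg (by linarith) (by positivity)
    nlinarith [iXb, k2]
  -- branch m_a + x Y_b : x Y_b ≤ x p' m_b = (p (1+u) - 1) m_b
  have b3 : u + (ma + x * Yb) ≤ p * Mn := by
    have hxY : x * Yb ≤ (p * (1 + u) - 1) * mb := by
      have := mul_le_mul_of_nonneg_left iYb hx
      rw [← mul_assoc, hid] at this; exact this
    rcases le_total mb ma with h | h
    · -- use Mn ≥ u + m_a + u m_b : slack (p-1)(u + m_a - m_b)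
      have : 0 ≤ (p - 1) * (u + ma - mb) := mul_nonneg (by linarith) (by linarith)
      nlinarith [hxY, k1]
    · -- use Mn ≥ u + m_b + u m_a : slack (p-1) u + (1 - p u)(m_b - m_a)
      have : 0 ≤ (1 - p * u) * (mb - ma) := mul_nonneg (by linarith) (by linarith)
      nlinarith [hxY, k2]
  have b4 : u + (mb + x * Ya) ≤ p * Mn := by
    have hxY : x * Ya ≤ (p * (1 + u) - 1) * ma := by
      have := mul_le_mul_of_nonneg_left iYa hx
      rw [← mul_assoc, hid] at this; exact this
    rcases le_total ma mb with h | h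
    · have : 0 ≤ (p - 1) * (u + mb - ma) := mul_nonneg (by linarith) (by linarith)
      nlinarith [hxY, k2]
    · have : 0 ≤ (1 - p * u) * (ma - mb) := mul_nonneg (by linarith) (by linarith)
      nlinarith [hxY, k1]
  have hb1 : Xa + u * mb ≤ p * Mn - u := by linarith
  have hb2 : Xb + u * ma ≤ p * Mn - u := by linarith
  have hb3 : ma + x * Yb ≤ p * Mn - u := by linarith
  have hb4 : mb + x * Ya ≤ p * Mn - u := by linarith
  have := max_le (max_le hb1 hb2) (max_le hb3 hb4)
  linarith

/-! ## R21g for the demotion polynomials -/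

section Ratio

variable {q : ℕ}

/-- **R21g IN POLYNOMIAL FORM (opt gen 14; every tree).**  For `0 < u ≤ 1` and `x, y > 0` with
`x y = u`, `u² ≤ x`, `u x ≤ 1`, `u² ≤ y`, `u y ≤ 1`:
`E_t(x) ≤ (1+u+x)/(1+u+u²) · μ_t` and `E_t(y) ≤ (1+u+y)/(1+u+u²) · μ_t`. -/
theorem excess_le_ratio {u x y : ℚ} (hu0 : 0 < u) (hu1 : u ≤ 1) (hx0 : 0 < x) (hy0 : 0 < y)
    (hxy : x * y = u) (hx2 : u * u ≤ x) (hx1 : u * x ≤ 1) (hy2 : u * u ≤ y) (hy1 : u * y ≤ 1) :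
    ∀ t : SumTree,
      treeQf u t x - 1 - x ≤ (1 + u + x) / (1 + u + u * u) * (treeM u t - 1) ∧
        treeQf u t y - 1 - y ≤ (1 + u + y) / (1 + u + u * u) * (treeM u t - 1) := by
  set D := 1 + u + u * u with hD
  have hDpos : 0 < D := by rw [hD]; positivity
  set p := (1 + u + x) / D with hp
  set p' := (1 + u + y) / D with hp'
  have hpD : p * D = 1 + u + x := by rw [hp]; field_simp
  have hp'D : p' * D = 1 + u + y := by rw [hp']; field_simp
  have hp1 : 1 ≤ p := by rw [hp, le_div_iff₀ hDpos]; nlinarith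
  have hp'1 : 1 ≤ p' := by rw [hp', le_div_iff₀ hDpos]; nlinarith
  have hpu : p * u ≤ 1 := by
    rw [hp, div_mul_eq_mul_div, div_le_one hDpos]; nlinarith
  have hp'u : p' * u ≤ 1 := by
    rw [hp', div_mul_eq_mul_div, div_le_one hDpos]; nlinarith
  -- the key identities x p' = p (1+u) - 1 and y p = p' (1+u) - 1
  have hid : x * p' = p * (1 + u) - 1 := by
    have e : (x * p' - (p * (1 + u) - 1)) * D = 0 := by
      have : x * p' * D = x * (1 + u + y) := by rw [mul_assoc, hp'D]
      nlinarith [this, hpD, hxy]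
    have := mul_eq_zero.1 e
    rcases this with h | h
    · linarith
    · exact absurd h hDpos.ne'
  have hid' : y * p = p' * (1 + u) - 1 := by
    have e : (y * p - (p' * (1 + u) - 1)) * D = 0 := by
      have : y * p * D = y * (1 + u + x) := by rw [mul_assoc, hpD]
      nlinarith [this, hp'D, hxy]
    have := mul_eq_zero.1 e
    rcases this with h | h
    · linarith
    · exact absurd h hDpos.ne'
  have hux : u / x = y := by rw [← hxy]; field_simp
  have huy : u / y = x := by rw [← hxy]; field_simp
  intro t
  induction t with
  | leaf z => simp
  | node a b iha ihb =>
      obtain ⟨iXa, iYa⟩ := iha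
      obtain ⟨iXb, iYb⟩ := ihb
      have hma : 0 ≤ treeM u a - 1 := by linarith [one_le_treeM hu0.le a]
      have hmb : 0 ≤ treeM u b - 1 := by linarith [one_le_treeM hu0.le b]
      obtain ⟨hM1', hM2'⟩ := treeM_node_sub_one_ge hu0.le hu1 a b
      have hM1 : u + ((treeM u a - 1) + u * (treeM u b - 1)) ≤ treeM u (.node a b) - 1 := by
        linarith
      have hM2 : u + ((treeM u b - 1) + u * (treeM u a - 1)) ≤ treeM u (.node a b) - 1 := by
        linarith
      constructor
      · rw [treeQf_excess_node u a b hx0.ne', hux]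
        exact twoFamRatio_node_half hu0.le hx0.le hp1 hpu hid hma hmb iXa iXb iYa iYb hM1 hM2
      · rw [treeQf_excess_node u a b hy0.ne', huy]
        exact twoFamRatio_node_half hu0.le hy0.le hp'1 hp'u hid' hma hmb iYa iYb iXa iXb hM1 hM2

/-- **R21g IN ROUTING VALUES (opt gen 14 §3b; every tree, every `q ≥ 2`, `1 ≤ i ≤ q - 1`).**
`BR_t{0, -i} ≤ p_i · BR_t{0}`, `p_i = (1 + u + 2^-i)/(1 + u + u²)`, `u = 2^-q`. -/
theorem treeBR_twoFam_ratio (hq : 2 ≤ q) {i : ℕ} (hi : 1 ≤ i) (hiq : i + 1 ≤ q) (t : SumTree) :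
    treeBR q t {0, -(i : ℤ)} ≤
      (1 + unitRoundoff q + (2 : ℚ) ^ (-(i : ℤ))) /
          (1 + unitRoundoff q + unitRoundoff q * unitRoundoff q) * treeBR q t {0} := by
  have hq1 : 1 ≤ q := by omega
  set u := unitRoundoff q with hudef
  set x : ℚ := (2 : ℚ) ^ (-(i : ℤ)) with hxdef
  set y : ℚ := (2 : ℚ) ^ ((i : ℤ) - q) with hydef
  have hu0 : 0 < u := by rw [hudef]; unfold unitRoundoff; positivity
  have hu1 : u ≤ 1 := unitRoundoff_le_one q
  have huz : u = (2 : ℚ) ^ (-(q : ℤ)) := unitRoundoff_eq_zpow q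
  have hx0 : 0 < x := zpow_pos (by norm_num) _
  have hy0 : 0 < y := zpow_pos (by norm_num) _
  have hxy : x * y = u := by
    rw [huz, hxdef, hydef, ← zpow_add₀ (by norm_num : (2 : ℚ) ≠ 0)]; congr 1; ring
  have huu : u * u = (2 : ℚ) ^ (-(q : ℤ) + -(q : ℤ)) := by
    rw [huz, ← zpow_add₀ (by norm_num : (2 : ℚ) ≠ 0)]
  have hx2 : u * u ≤ x := by
    rw [huu, hxdef]; exact zpow_le_zpow_right₀ (by norm_num) (by omega)
  have hy2 : u * u ≤ y := by
    rw [huu, hydef]; exact zpow_le_zpow_right₀ (by norm_num) (by omega)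
  have hx1 : u * x ≤ 1 := by
    rw [huz, hxdef, ← zpow_add₀ (by norm_num : (2 : ℚ) ≠ 0)]
    exact zpow_le_one_of_nonpos₀ (by norm_num) (by omega)
  have hy1 : u * y ≤ 1 := by
    rw [huz, hydef, ← zpow_add₀ (by norm_num : (2 : ℚ) ≠ 0)]
    exact zpow_le_one_of_nonpos₀ (by norm_num) (by omega)
  have h := (excess_le_ratio hu0 hu1 hx0 hy0 hxy hx2 hx1 hy2 hy1 t).1
  -- transport: u · BR{0,-i} = E(x), u · BR{0} = μ
  have h0 := mul_treeBR_zero_pair hq1 t (e := -(i : ℤ)) (by omega) (by omega)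
  have h1 := mul_treeBR_zero hq1 t
  rw [← hxdef, ← hudef] at h0
  rw [← hudef] at h1
  have hD : 0 < 1 + u + u * u := by positivity
  have key : u * treeBR q t {0, -(i : ℤ)} ≤ u * ((1 + u + x) / (1 + u + u * u) * treeBR q t {0}) := by
    rw [h0, show u * ((1 + u + x) / (1 + u + u * u) * treeBR q t {0}) =
      (1 + u + x) / (1 + u + u * u) * (u * treeBR q t {0}) by ring, h1]
    exact h
  exact le_of_mul_le_mul_left key hu0

/-- **THE TOP-LEVEL `O`-ROW WITH NO OFFSET, EVERY TREE, EVERY `q ≥ 2` (opt R21 corollary).**  In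
budget units, with `β = 2^(q-2)`, `o = 2^(q-1) - β + ½ = β + ½`:
`2 BR_t(o) ≤ (1+ρ) BR_t(o + β - ½) + (1-ρ) BR_t(o - β)` whenever
`u (1 - 2u - u²) ≤ ρ (1 - u³)` (`ρ ≥ ρ_o`, opt's exact constant), e.g. `ρ = u`. -/
theorem treeBRv_oRow_top_zero (hq : 2 ≤ q) (t : SumTree) {ρ : ℚ}
    (hρ : unitRoundoff q * (1 - 2 * unitRoundoff q - unitRoundoff q ^ 2) ≤ ρ * (1 - unitRoundoff q ^ 3)) :
    let β : ℚ := (2 : ℚ) ^ (q - 2)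
    let o : ℚ := (2 : ℚ) ^ (q - 1) - β + ((0 : ℕ) : ℚ) + 1 / 2
    2 * treeBRv q t o ≤ (1 + ρ) * treeBRv q t (o + β - 1 / 2) + (1 - ρ) * treeBRv q t (o - β) := by
  intro β o
  have hq1 : 1 ≤ q := by omega
  set u := unitRoundoff q with hudef
  have hu0 : 0 < u := by rw [hudef]; unfold unitRoundoff; positivity
  have hu1 : u ≤ 1 / 4 := by
    rw [hudef]; unfold unitRoundoff
    have : (4 : ℚ) ≤ 2 ^ q := by
      have : (2 : ℚ) ^ 2 ≤ 2 ^ q := pow_le_pow_right₀ (by norm_num) hq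
      norm_num at this; exact this
    rw [div_le_div_iff₀ (by positivity) (by norm_num)]; linarith
  -- R21g at i = q - 1
  have hR := treeBR_twoFam_ratio hq (i := q - 1) (by omega) (by omega) t
  rw [← hudef] at hR
  -- the three points as configurations
  have hβ : β = (2 : ℚ) ^ ((q : ℤ) - 2) := by
    show (2 : ℚ) ^ (q - 2) = _; rw [← zpow_natCast]; congr 1; omega
  have hσ : (2 : ℚ) ^ (q - 1) = (2 : ℚ) ^ ((q : ℤ) - 1) := by
    rw [← zpow_natCast]; congr 1; omega
  have h21 : (2 : ℚ) ^ ((q : ℤ) - 1) = 2 * (2 : ℚ) ^ ((q : ℤ) - 2) := by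
    rw [show (q : ℤ) - 1 = (q : ℤ) - 2 + 1 by ring, zpow_add_one₀ (by norm_num)]; ring
  have ho : o = val ({(q : ℤ) - 2, -1} : Finset ℤ) := by
    rw [val_pair (by omega), zpow_neg_one]
    show (2 : ℚ) ^ (q - 1) - β + ((0 : ℕ) : ℚ) + 1 / 2 = _
    rw [hβ, hσ, h21]; push_cast; ring
  have ho1 : o + β - 1 / 2 = val ({(q : ℤ) - 1} : Finset ℤ) := by
    unfold val; rw [Finset.sum_singleton]
    show (2 : ℚ) ^ (q - 1) - β + ((0 : ℕ) : ℚ) + 1 / 2 + β - 1 / 2 = _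
    rw [hσ]; push_cast; ring
  have ho2 : o - β = val ({(-1 : ℤ)} : Finset ℤ) := by
    unfold val; rw [Finset.sum_singleton, zpow_neg_one]
    show (2 : ℚ) ^ (q - 1) - β + ((0 : ℕ) : ℚ) + 1 / 2 - β = _
    rw [hβ, hσ, h21]; push_cast; ring
  rw [ho1, ho2, ho, treeBRv_val, treeBRv_val, treeBRv_val]
  -- shifts: {q-2,-1} = {0,-(q-1)} + (q-2); {q-1} = {0} + (q-1); {-1} = {0} + (-1)
  have s1 := treeBR_image_add (q := q) t ({0, -((q - 1 : ℕ) : ℤ)} : Finset ℤ) ((q : ℤ) - 2)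
  rw [image_pair_add] at s1
  have i1 : ({0 + ((q : ℤ) - 2), -((q - 1 : ℕ) : ℤ) + ((q : ℤ) - 2)} : Finset ℤ) = {(q : ℤ) - 2, -1} := by
    ext z; simp only [Finset.mem_insert, Finset.mem_singleton]; omega
  rw [i1] at s1
  have s2 := treeBR_image_add (q := q) t ({0} : Finset ℤ) ((q : ℤ) - 1)
  have s3 := treeBR_image_add (q := q) t ({0} : Finset ℤ) (-1 : ℤ)
  rw [Finset.image_singleton, zero_add] at s2 s3
  rw [s1, s2, s3]
  -- now: 2·2^(q-2) BR{0,-(q-1)} ≤ (1+ρ) 2^(q-1) BR{0} + (1-ρ) 2^-1 BR{0}, from BR{0,-(q-1)} ≤ p BR{0}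
  have hx : (2 : ℚ) ^ (-((q - 1 : ℕ) : ℤ)) = 2 * u := by
    rw [hudef, unitRoundoff_eq_zpow, show (-((q - 1 : ℕ) : ℤ)) = -(q : ℤ) + 1 by omega,
      zpow_add_one₀ (by norm_num)]; ring
  rw [hx] at hR
  have hB0 : 0 ≤ treeBR q t {0} := treeBR_nonneg q t _
  have hpos : 0 < (2 : ℚ) ^ ((q : ℤ) - 2) := zpow_pos (by norm_num) _
  rw [h21, zpow_neg_one]
  have hD : 0 < 1 + u + u * u := by positivity
  -- p ≤ 1 + ρ + (1-ρ) u  ⟸  u(1-2u-u²) ≤ ρ(1-u³)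
  have hcoef : (1 + u + 2 * u) / (1 + u + u * u) ≤ 1 + ρ + (1 - ρ) * u := by
    rw [div_le_iff₀ hD]
    have hρ' : u * (1 - 2 * u - u ^ 2) ≤ ρ * (1 - u ^ 3) := hρ
    nlinarith [hρ']
  have k := mul_le_mul_of_nonneg_right hcoef hB0
  have k2 : treeBR q t {0, -((q - 1 : ℕ) : ℤ)} ≤ (1 + ρ + (1 - ρ) * u) * treeBR q t {0} := le_trans hR k
  have hu2 : 2 * (2 : ℚ) ^ ((q : ℤ) - 2) * u = 2⁻¹ := by
    rw [hudef, unitRoundoff_eq_zpow, mul_assoc, ← zpow_add₀ (by norm_num : (2 : ℚ) ≠ 0),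
      show (q : ℤ) - 2 + -(q : ℤ) = -2 by ring]
    norm_num
  have k3 := mul_le_mul_of_nonneg_left k2 (by positivity : (0 : ℚ) ≤ 2 * (2 : ℚ) ^ ((q : ℤ) - 2))
  have e : 2 * (2 : ℚ) ^ ((q : ℤ) - 2) * ((1 + ρ + (1 - ρ) * u) * treeBR q t {0}) =
      (1 + ρ) * (2 * (2 : ℚ) ^ ((q : ℤ) - 2) * treeBR q t {0}) + (1 - ρ) * (2⁻¹ * treeBR q t {0}) := by
    rw [← hu2]; ring
  rw [e] at k3
  linarith [k3]

/-- The same row at `ρ = u`. -/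
theorem treeBRv_oRow_top_zero_u (hq : 2 ≤ q) (t : SumTree) :
    let β : ℚ := (2 : ℚ) ^ (q - 2)
    let o : ℚ := (2 : ℚ) ^ (q - 1) - β + ((0 : ℕ) : ℚ) + 1 / 2
    2 * treeBRv q t o ≤ (1 + unitRoundoff q) * treeBRv q t (o + β - 1 / 2) +
      (1 - unitRoundoff q) * treeBRv q t (o - β) := by
  refine treeBRv_oRow_top_zero hq t ?_
  have hu0 : 0 ≤ unitRoundoff q := unitRoundoff_nonneg q
  have hu1 : unitRoundoff q ≤ 1 := unitRoundoff_le_one q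
  nlinarith [mul_nonneg hu0 hu0, mul_nonneg (mul_nonneg hu0 hu0) hu0]

end Ratio

end Summit.Ventures.CertifiedArithmetic.LowPrec.Opt
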